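import Summits.QuantumFields.BalabanUV.Beta.D1BFx.MixedVarPackedHess

/-!
# `BalabanUV.Beta.D1BFx.ColourLift` — road «BF-x» for binder row D1, slot (K), X₃(ii) ROUTE T, brick **K-TA4C «THE ANTISYMMETRIC (COLOUR)
# LIFT OF THE JET IDENTITY»** (`HOME/b2b-balaban-beta-d1-p2/K-ASSEMBLY-SPEC-v2.md` v2.2, owner FINDING F-g6-1), PART 1 — THE LIFT
# ALGEBRA: the colour generator `C = [[0,1],[−1,0]]` (`Cᵀ = −C`, `C² = −1`, `tr C = 0`, `tr C² = −2`), Kronecker lifts `1 ⊗ X`, `c ⊗ x`,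
# `(c·c) ⊗ x` versus the bordered block matrices (`kkt`, `fromRows`) up to the canonical re-indexings, the UNIFORM COLOUR FACTOR of the
# one-loop functionals (`mixedVar`, `hessT` of lifted jets `= tr(c·c) ×` the stripped functional), the TWO-SIDED Ward relations of the
# lifted data from the COLOURLESS one-sided letters and the parity types, and lifted nondegeneracy

HONEST DEPENDENCY (cell records, verbatim): «continuum YM on T⁴ ⇐ BetaPertH ∧ nine spine estimates (0/9 proved); BetaPertH ⇐ (D1) ∧ (D4) ∧
CAP+tail; G-an2-4 gates asym, D1 and NE2/3/4.»  HONEST FRAMING (cell contract, verbatim): «discharging `BetaPertH` makes Bałaban's UV stability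
UNCONDITIONAL — a real constructive-QFT result; it is NOT the continuum limit and NOT the Clay problem.»  THIS MODULE DISCHARGES NOTHING of (K),
of D1 or of the wall: [folklore] finite-dimensional linear algebra over Mathlib's `Matrix.kroneckerMap` API (`mul_kronecker_mul`,
`trace_kronecker`, `det_kronecker`, `inv_kronecker`, `kroneckerMap_transpose`), the tree's `Beta.Composition.kkt`, the road owner's
`SliceTransferJetsMixed.mixedVar` and this lineage's TA4 `MixedVarPackedHess.hessT`, all BY NAME.  [our object] data: `cgen`, the re-indexings
`e₂`, `e₃`.  No `def … : Prop`, nothing cited, no wall binder instantiated, 0 sorry.  NOT D1, NOT BetaPertH, NOT continuum, NOT Clay.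

ABSOLUTE RULE (cell charter, verbatim): «No internally-minted statement may enter as a cited fact. Every hypothesis is either kernel-proved in this
package or a verbatim quotation of a PUBLISHED theorem with page reference. The manuscript(s) under audit are NOT citable for their own disputed
steps — they are the thing under adjudication; programme-internal (2001/route/tribunal) claims are never citable.»

WHY (owner FINDING F-g6-1, journal 2026-08-20T22:20Z; K-ASSEMBLY-SPEC v2.2).  The cell's kernels are COLOURLESS instances with PARITY TYPES (legs
sign-conjugate symmetric, first-order tables odd — antisymmetric ff —, second-order tables even); K-TA4G (honest real matrices, TWO-SIDED Ward
relations) is therefore not instantiated on them directly.  The repair: lift colourless typed data by ONE real antisymmetric `c` (`c = C`,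
`C² = −1`): zeroth jets `1 ⊗ X₀`, first jets `c ⊗ x₁`, second jets `(c·c) ⊗ x₂`.  THIS FILE supplies everything about the lift that does not
mention K-TA4G: §1 `cgen`; §2 [folklore] `fromBlocks_kronecker`, `fromRows_kronecker`, **`kkt_kronecker`** (`kkt (c⊗K) [c⊗Q; c⊗T]` is the
`e₃`-re-indexed lift `c ⊗ [[K, s•[Q;T]ᵀ],[[Q;T],0]]` when `cᵀ = s•c` — for `s = −1` the SIGNED bordered jet `[[k, −qᵀ],[q, 0]]` of F-g6-1),
`kkt_kronecker₂`, `kkt_kronecker_symm`, `submatrix_reindex_e₃`; §3 [folklore] `mixedVar_reindex`, `hessT_reindex_lift`, **`mixedVar_kronecker_lift`**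
∕ **`hessT_kronecker_lift`** (`= tr(c·c) ×` the stripped functional — the tadpole and the bubble BOTH carry `c·c`), `det_one_kronecker_ne_zero`;
§4 [folklore] the lifted Ward relations `lift_rel₀∕₁∕₂∕_mix` (one-sided, any `c`) and **`lift_rel₁_transpose`∕`lift_rel₂_transpose`∕
`lift_rel_mix_transpose`** (the transposed side, from `cᵀ = −c` and the parity types `K₀ᵀ = K₀`, `k₁ᵀ = −k₁`, `k₂ᵀ = k₂`, `kₛₜᵀ = kₛₜ` — this is
where the types are consumed, nothing else); §5 `det_lift_mul_ne_zero`, `det_kkt_lift_ne_zero`.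
NOT HERE (PART 2): K-TA4G's `mixedVar_gramTransfer_jets` at the lifted data and the stripped read-out (twisted Gram jets).
Provenance: G-an2-4 formalisation swarm leaf seat `b2b-balaban-gan24-formalise-leaf-03` gen 44 (cross-lane), claim «K-TA4C» PART 1, 2026-08-20.
-/

namespace Summit.QuantumFields.BalabanUV.Beta.D1BFx.ColourLift

open Matrix
open scoped Kronecker
open Literature.MathematicalPhysics.QuantumFieldTheory.Balaban1983to89.Beta.Composition (kkt)
open Summit.QuantumFields.BalabanUV.Beta.D1BFx.SliceTransferJetsMixed (mixedVar)
open Summit.QuantumFields.BalabanUV.Beta.D1BFx.MixedVarPackedHess (hessT)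

/-! ## §1 The colour generator `C` (`so(2)`: `Cᵀ = −C`, `C² = −1`, `tr C = 0`, `tr C² = −2`) -/

/-- [our object] THE COLOUR GENERATOR: the rotation generator of the plane, `C = [[0, 1], [−1, 0]]`. -/
def cgen : Matrix (Fin 2) (Fin 2) ℝ := !![0, 1; -1, 0]

/-- [folklore] `Cᵀ = −C`. -/
theorem cgen_transpose : cgenᵀ = -cgen := by
  ext i j; fin_cases i <;> fin_cases j <;> simp [cgen]

/-- [folklore] `C·C = −1`. -/
theorem cgen_mul_cgen : cgen * cgen = -1 := by
  ext i j; fin_cases i <;> fin_cases j <;> simp [cgen, Matrix.mul_apply, Fin.sum_univ_two]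

/-- [folklore] `tr C = 0`. -/
theorem trace_cgen : cgen.trace = 0 := by
  simp [cgen, Matrix.trace, Fin.sum_univ_two]

/-- [folklore] `tr (C·C) = −2`. -/
theorem trace_cgen_mul_cgen : (cgen * cgen).trace = -2 := by
  rw [cgen_mul_cgen, Matrix.trace_neg, Matrix.trace_one, Fintype.card_fin]; norm_num

/-- [folklore] `(C·C)ᵀ = C·C`. -/
theorem cgen_sq_transpose : (cgen * cgen)ᵀ = cgen * cgen := by
  rw [cgen_mul_cgen, Matrix.transpose_neg, Matrix.transpose_one]

/-- [folklore] `Cᵀ·C = 1` (`= −C² `). -/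
theorem cgen_transpose_mul_cgen : cgenᵀ * cgen = 1 := by
  rw [cgen_transpose, Matrix.neg_mul, cgen_mul_cgen, neg_neg]

/-! ## §2 Kronecker lifts versus block matrices (up to the canonical re-indexing) -/

section Blocks

variable {l ν μ ρ ν' μ' : Type*}

/-- [our object] The re-indexing `l × (ν ⊕ μ) ≃ (l × ν) ⊕ (l × μ)`. -/
def e₂ (l ν μ : Type*) : l × (ν ⊕ μ) ≃ (l × ν) ⊕ (l × μ) := Equiv.prodSumDistrib l ν μ

/-- [our object] The re-indexing `l × (ν ⊕ (μ ⊕ ρ)) ≃ (l × ν) ⊕ ((l × μ) ⊕ (l × ρ))`. -/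
def e₃ (l ν μ ρ : Type*) : l × (ν ⊕ (μ ⊕ ρ)) ≃ (l × ν) ⊕ ((l × μ) ⊕ (l × ρ)) :=
  (Equiv.prodSumDistrib l ν (μ ⊕ ρ)).trans (Equiv.sumCongr (Equiv.refl _) (Equiv.prodSumDistrib l μ ρ))

/-- [our object] `e₂⁻¹` on the first summand. -/
@[simp] theorem e₂_symm_inl (i : l) (x : ν) : (e₂ l ν μ).symm (Sum.inl (i, x)) = (i, Sum.inl x) := rfl
/-- [our object] `e₂⁻¹` on the second summand. -/
@[simp] theorem e₂_symm_inr (i : l) (y : μ) : (e₂ l ν μ).symm (Sum.inr (i, y)) = (i, Sum.inr y) := rfl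
/-- [our object] `e₃⁻¹` on the first summand. -/
@[simp] theorem e₃_symm_inl (i : l) (x : ν) : (e₃ l ν μ ρ).symm (Sum.inl (i, x)) = (i, Sum.inl x) := rfl
/-- [our object] `e₃⁻¹` on the middle summand. -/
@[simp] theorem e₃_symm_inr_inl (i : l) (y : μ) : (e₃ l ν μ ρ).symm (Sum.inr (Sum.inl (i, y))) = (i, Sum.inr (Sum.inl y)) := rfl
/-- [our object] `e₃⁻¹` on the last summand. -/
@[simp] theorem e₃_symm_inr_inr (i : l) (r : ρ) : (e₃ l ν μ ρ).symm (Sum.inr (Sum.inr (i, r))) = (i, Sum.inr (Sum.inr r)) := rfl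

/-- [folklore] **KRONECKER COMMUTES WITH `fromBlocks`** (up to `e₂`). -/
theorem fromBlocks_kronecker (c : Matrix l l ℝ) (A : Matrix ν ν' ℝ) (B : Matrix ν μ' ℝ) (C' : Matrix μ ν' ℝ) (D : Matrix μ μ' ℝ) :
    fromBlocks (c ⊗ₖ A) (c ⊗ₖ B) (c ⊗ₖ C') (c ⊗ₖ D) = reindex (e₂ l ν μ) (e₂ l ν' μ') (c ⊗ₖ fromBlocks A B C' D) := by
  ext a b
  rcases a with ⟨i, x⟩ | ⟨i, y⟩ <;> rcases b with ⟨j, x'⟩ | ⟨j, y'⟩ <;>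
    simp [Matrix.reindex_apply, Matrix.submatrix_apply, Matrix.kroneckerMap_apply, Matrix.fromBlocks]

/-- [folklore] Kronecker commutes with `fromRows` (up to `e₂` on the rows). -/
theorem fromRows_kronecker (c : Matrix l l ℝ) (Q : Matrix μ ν ℝ) (T : Matrix ρ ν ℝ) :
    fromRows (c ⊗ₖ Q) (c ⊗ₖ T) = reindex (e₂ l μ ρ) (Equiv.refl _) (c ⊗ₖ fromRows Q T) := by
  ext a b
  rcases a with ⟨i, y⟩ | ⟨i, r⟩ <;> simp [Matrix.reindex_apply, Matrix.submatrix_apply, Matrix.kroneckerMap_apply, Matrix.fromRows]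

/-- [folklore] Transpose of a Kronecker lift: `(c ⊗ X)ᵀ = cᵀ ⊗ Xᵀ`. -/
theorem kronecker_transpose' (c : Matrix l l ℝ) (X : Matrix ν μ ℝ) : (c ⊗ₖ X)ᵀ = cᵀ ⊗ₖ Xᵀ :=
  (Matrix.kroneckerMap_transpose _ _ _).symm

/-- [folklore] Entries of a sign-symmetric colour matrix: `cᵀ = s•c` means `c j i = s·c i j`. -/
theorem transpose_eq_smul_apply {c : Matrix l l ℝ} {s : ℝ} (hc : cᵀ = s • c) (i j : l) : c j i = s * c i j := by
  have := congrFun (congrFun hc i) j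
  simpa [Matrix.transpose_apply, Matrix.smul_apply] using this

/-- [folklore] **THE LIFTED DOUBLY BORDERED MATRIX**: for a colour matrix with `cᵀ = s•c` (`s = 1`: `c = 1` or `C²`; `s = −1`: `c = C`),
`kkt (c⊗K) [c⊗Q; c⊗T] = e₃-reindex of c ⊗ [[K, s•[Q;T]ᵀ], [[Q;T], 0]]` — the lift of the SIGNED bordered matrix. -/
theorem kkt_kronecker {c : Matrix l l ℝ} {s : ℝ} (hc : cᵀ = s • c) (K : Matrix ν ν ℝ) (Q : Matrix μ ν ℝ) (T : Matrix ρ ν ℝ) :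
    kkt (c ⊗ₖ K) (fromRows (c ⊗ₖ Q) (c ⊗ₖ T))
      = reindex (e₃ l ν μ ρ) (e₃ l ν μ ρ) (c ⊗ₖ fromBlocks K (s • (fromRows Q T)ᵀ) (fromRows Q T) 0) := by
  have hc' := transpose_eq_smul_apply hc
  ext a b
  rcases a with ⟨i, x⟩ | ⟨i, y⟩ | ⟨i, r⟩ <;> rcases b with ⟨j, x'⟩ | ⟨j, y'⟩ | ⟨j, r'⟩ <;>
    simp [kkt, Matrix.reindex_apply, Matrix.submatrix_apply, Matrix.kroneckerMap_apply, Matrix.fromBlocks, Matrix.fromRows, hc' i j,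
      mul_comm, mul_left_comm]

/-- [folklore] The two-block version (TA4's jets `kkt Kₛ Qₛ` on `ν ⊕ μ`): `kkt (c⊗K) (c⊗Q) = e₂-reindex of c ⊗ [[K, s•Qᵀ],[Q, 0]]`. -/
theorem kkt_kronecker₂ {c : Matrix l l ℝ} {s : ℝ} (hc : cᵀ = s • c) (K : Matrix ν ν ℝ) (Q : Matrix μ ν ℝ) :
    kkt (c ⊗ₖ K) (c ⊗ₖ Q) = reindex (e₂ l ν μ) (e₂ l ν μ) (c ⊗ₖ fromBlocks K (s • Qᵀ) Q 0) := by
  have hc' := transpose_eq_smul_apply hc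
  ext a b
  rcases a with ⟨i, x⟩ | ⟨i, y⟩ <;> rcases b with ⟨j, x'⟩ | ⟨j, y'⟩ <;>
    simp [kkt, Matrix.reindex_apply, Matrix.submatrix_apply, Matrix.kroneckerMap_apply, Matrix.fromBlocks, hc' i j, mul_comm, mul_left_comm]

/-- [folklore] The unsigned two-block case `cᵀ = c`: `kkt (c⊗K) (c⊗Q) = e₂-reindex of c ⊗ kkt K Q`. -/
theorem kkt_kronecker₂_symm {c : Matrix l l ℝ} (hc : cᵀ = c) (K : Matrix ν ν ℝ) (Q : Matrix μ ν ℝ) :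
    kkt (c ⊗ₖ K) (c ⊗ₖ Q) = reindex (e₂ l ν μ) (e₂ l ν μ) (c ⊗ₖ kkt K Q) := by
  rw [kkt_kronecker₂ (s := 1) (by rw [one_smul]; exact hc), one_smul]; rfl

/-- [folklore] The unsigned case `cᵀ = c` (e.g. `c = 1`, `c = C²`): `kkt (c⊗K) [c⊗Q; c⊗T] = e₃-reindex of c ⊗ kkt K [Q;T]`. -/
theorem kkt_kronecker_symm {c : Matrix l l ℝ} (hc : cᵀ = c) (K : Matrix ν ν ℝ) (Q : Matrix μ ν ℝ) (T : Matrix ρ ν ℝ) :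
    kkt (c ⊗ₖ K) (fromRows (c ⊗ₖ Q) (c ⊗ₖ T)) = reindex (e₃ l ν μ ρ) (e₃ l ν μ ρ) (c ⊗ₖ kkt K (fromRows Q T)) := by
  rw [kkt_kronecker (s := 1) (by rw [one_smul]; exact hc), one_smul]; rfl

/-- [folklore] The packed `(ν ⊕ μ)`-corner of an `e₃`-re-indexed lift is the `e₂`-re-indexed lift of the corner. -/
theorem submatrix_reindex_e₃ (c : Matrix l l ℝ) (X : Matrix (ν ⊕ (μ ⊕ ρ)) (ν ⊕ (μ ⊕ ρ)) ℝ) :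
    (reindex (e₃ l ν μ ρ) (e₃ l ν μ ρ) (c ⊗ₖ X)).submatrix (Sum.map id Sum.inl) (Sum.map id Sum.inl)
      = reindex (e₂ l ν μ) (e₂ l ν μ) (c ⊗ₖ X.submatrix (Sum.map id Sum.inl) (Sum.map id Sum.inl)) := by
  ext a b
  rcases a with ⟨i, x⟩ | ⟨i, y⟩ <;> rcases b with ⟨j, x'⟩ | ⟨j, y'⟩ <;>
    simp [Matrix.reindex_apply, Matrix.submatrix_apply, Matrix.kroneckerMap_apply]

end Blocks

/-! ## §3 The one-loop functionals of lifted data: re-indexing invariance and the uniform colour factor `tr(c²)` -/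

section Functionals

variable {ι κ l : Type*} [Fintype ι] [Fintype κ] [Fintype l] [DecidableEq ι] [DecidableEq κ] [DecidableEq l]

/-- [folklore] `mixedVar` is invariant under a simultaneous re-indexing of the four jets. -/
theorem mixedVar_reindex (e : ι ≃ κ) (A₀ A₁ A₁' A₂ : Matrix ι ι ℝ) :
    mixedVar (reindex e e A₀) (reindex e e A₁) (reindex e e A₁') (reindex e e A₂) = mixedVar A₀ A₁ A₁' A₂ := by
  have htr : ∀ X : Matrix ι ι ℝ, (X.submatrix e.symm e.symm).trace = X.trace := fun X => by
    simp only [Matrix.trace, Matrix.diag, Matrix.submatrix_apply]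
    exact e.symm.sum_comp (fun i => X i i)
  unfold mixedVar
  rw [Matrix.inv_reindex]
  simp only [Matrix.reindex_apply, Matrix.submatrix_mul_equiv, htr]

omit [DecidableEq ι] [DecidableEq κ] in
/-- [folklore] `hessT` is invariant under a simultaneous re-indexing (leg and jets). -/
theorem hessT_reindex_lift (e : ι ≃ κ) (L V V' W : Matrix ι ι ℝ) :
    hessT (reindex e e L) (reindex e e V) (reindex e e V') (reindex e e W) = hessT L V V' W := by
  have htr : ∀ X : Matrix ι ι ℝ, (X.submatrix e.symm e.symm).trace = X.trace := fun X => by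
    simp only [Matrix.trace, Matrix.diag, Matrix.submatrix_apply]
    exact e.symm.sum_comp (fun i => X i i)
  unfold hessT
  simp only [Matrix.reindex_apply, Matrix.submatrix_mul_equiv, htr]

/-- [folklore] **THE UNIFORM COLOUR FACTOR, `mixedVar`**: zeroth jet `1 ⊗ M`, first jets `c ⊗ J`, `c ⊗ J′`, second jet `(c·c) ⊗ J″` ⟹
`mixedVar = tr(c·c) · mixedVar M J J′ J″` (both the tadpole and the bubble carry exactly `c·c`). -/
theorem mixedVar_kronecker_lift (c : Matrix l l ℝ) (M J J' J'' : Matrix ι ι ℝ) :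
    mixedVar ((1 : Matrix l l ℝ) ⊗ₖ M) (c ⊗ₖ J) (c ⊗ₖ J') ((c * c) ⊗ₖ J'') = (c * c).trace * mixedVar M J J' J'' := by
  unfold mixedVar
  rw [Matrix.inv_kronecker, inv_one]
  simp only [← Matrix.mul_kronecker_mul, Matrix.one_mul, Matrix.trace_kronecker]
  ring

omit [DecidableEq ι] in
/-- [folklore] **THE UNIFORM COLOUR FACTOR, `hessT`**: leg `1 ⊗ L`, first jets `c ⊗ j`, `c ⊗ j′`, second jet `(c·c) ⊗ w` ⟹
`hessT = tr(c·c) · hessT L j j′ w`. -/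
theorem hessT_kronecker_lift (c : Matrix l l ℝ) (L j j' w : Matrix ι ι ℝ) :
    hessT ((1 : Matrix l l ℝ) ⊗ₖ L) (c ⊗ₖ j) (c ⊗ₖ j') ((c * c) ⊗ₖ w) = (c * c).trace * hessT L j j' w := by
  unfold hessT
  simp only [← Matrix.mul_kronecker_mul, Matrix.one_mul, Matrix.trace_kronecker]
  ring

omit [Fintype ι] [DecidableEq ι] in
/-- [folklore] Lifted determinants: `det (1 ⊗ X) = (det X)^{|l|}`, nonzero iff `det X ≠ 0`. -/
theorem det_one_kronecker_ne_zero {X : Matrix κ κ ℝ} (hX : X.det ≠ 0) : (((1 : Matrix l l ℝ) ⊗ₖ X)).det ≠ 0 := by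
  rw [Matrix.det_kronecker, Matrix.det_one, one_pow, one_mul]
  exact pow_ne_zero _ hX

end Functionals

/-! ## §4 Lifting the COLOURLESS Ward letters: the two-sided relations of K-TA4G for the lifted data -/

section Ward

variable {l α ν ρ : Type*} [Fintype l] [Fintype ν] [DecidableEq l]

omit [Fintype l] [Fintype ν] [DecidableEq l] in
/-- [folklore] `(−A) ⊗ (−B) = A ⊗ B`. -/
theorem neg_kronecker_neg {m n p q : Type*} (A : Matrix m n ℝ) (B : Matrix p q ℝ) : (-A) ⊗ₖ (-B) = A ⊗ₖ B := by
  ext ⟨i, x⟩ ⟨j, y⟩; simp [Matrix.kroneckerMap_apply]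

omit [Fintype l] [Fintype ν] [DecidableEq l] in
/-- [folklore] `A ⊗ (−B) = −(A ⊗ B)`. -/
theorem kronecker_neg {m n p q : Type*} (A : Matrix m n ℝ) (B : Matrix p q ℝ) : A ⊗ₖ (-B) = -(A ⊗ₖ B) := by
  ext ⟨i, x⟩ ⟨j, y⟩; simp [Matrix.kroneckerMap_apply]

omit [Fintype l] [Fintype ν] [DecidableEq l] in
/-- [folklore] `(−A) ⊗ B = −(A ⊗ B)`. -/
theorem neg_kronecker {m n p q : Type*} (A : Matrix m n ℝ) (B : Matrix p q ℝ) : (-A) ⊗ₖ B = -(A ⊗ₖ B) := by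
  ext ⟨i, x⟩ ⟨j, y⟩; simp [Matrix.kroneckerMap_apply]

/-- [folklore] ZEROTH ORDER: `X₀W₀ = 0 ⟹ (1⊗X₀)(1⊗W₀) = 0`. -/
theorem lift_rel₀ {X₀ : Matrix α ν ℝ} {W₀ : Matrix ν ρ ℝ} (h : X₀ * W₀ = 0) :
    ((1 : Matrix l l ℝ) ⊗ₖ X₀) * ((1 : Matrix l l ℝ) ⊗ₖ W₀) = 0 := by
  rw [← Matrix.mul_kronecker_mul, Matrix.one_mul, h, Matrix.kronecker_zero]

/-- [folklore] FIRST ORDER (one-sided): `x₁W₀ + X₀w₁ = 0 ⟹ (c⊗x₁)(1⊗W₀) + (1⊗X₀)(c⊗w₁) = 0`. -/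
theorem lift_rel₁ (c : Matrix l l ℝ) {X₀ x₁ : Matrix α ν ℝ} {W₀ w₁ : Matrix ν ρ ℝ} (h : x₁ * W₀ + X₀ * w₁ = 0) :
    (c ⊗ₖ x₁) * ((1 : Matrix l l ℝ) ⊗ₖ W₀) + ((1 : Matrix l l ℝ) ⊗ₖ X₀) * (c ⊗ₖ w₁) = 0 := by
  rw [← Matrix.mul_kronecker_mul, ← Matrix.mul_kronecker_mul, Matrix.mul_one, Matrix.one_mul, ← Matrix.kronecker_add, h,
    Matrix.kronecker_zero]

/-- [folklore] SECOND ORDER (one-sided, pure): `x₂W₀ + 2·x₁w₁ + X₀w₂ = 0 ⟹ ((c·c)⊗x₂)(1⊗W₀) + 2·(c⊗x₁)(c⊗w₁) + (1⊗X₀)((c·c)⊗w₂) = 0`. -/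
theorem lift_rel₂ (c : Matrix l l ℝ) {X₀ x₁ x₂ : Matrix α ν ℝ} {W₀ w₁ w₂ : Matrix ν ρ ℝ}
    (h : x₂ * W₀ + (2 : ℝ) • (x₁ * w₁) + X₀ * w₂ = 0) :
    ((c * c) ⊗ₖ x₂) * ((1 : Matrix l l ℝ) ⊗ₖ W₀) + (2 : ℝ) • ((c ⊗ₖ x₁) * (c ⊗ₖ w₁))
      + ((1 : Matrix l l ℝ) ⊗ₖ X₀) * ((c * c) ⊗ₖ w₂) = 0 := by
  rw [← Matrix.mul_kronecker_mul, ← Matrix.mul_kronecker_mul, ← Matrix.mul_kronecker_mul, Matrix.mul_one, Matrix.one_mul,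
    ← Matrix.kronecker_smul, ← Matrix.kronecker_add, ← Matrix.kronecker_add, h, Matrix.kronecker_zero]

/-- [folklore] SECOND ORDER (one-sided, mixed): `xₛₜW₀ + xₛwₜ + xₜwₛ + X₀wₛₜ = 0` lifts with `c·c` on the second jets and `c` on the first. -/
theorem lift_rel_mix (c : Matrix l l ℝ) {X₀ xₛ xₜ xₛₜ : Matrix α ν ℝ} {W₀ wₛ wₜ wₛₜ : Matrix ν ρ ℝ}
    (h : xₛₜ * W₀ + xₛ * wₜ + xₜ * wₛ + X₀ * wₛₜ = 0) :
    ((c * c) ⊗ₖ xₛₜ) * ((1 : Matrix l l ℝ) ⊗ₖ W₀) + (c ⊗ₖ xₛ) * (c ⊗ₖ wₜ) + (c ⊗ₖ xₜ) * (c ⊗ₖ wₛ)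
      + ((1 : Matrix l l ℝ) ⊗ₖ X₀) * ((c * c) ⊗ₖ wₛₜ) = 0 := by
  rw [← Matrix.mul_kronecker_mul, ← Matrix.mul_kronecker_mul, ← Matrix.mul_kronecker_mul, ← Matrix.mul_kronecker_mul,
    Matrix.mul_one, Matrix.one_mul, ← Matrix.kronecker_add, ← Matrix.kronecker_add, ← Matrix.kronecker_add, h, Matrix.kronecker_zero]

variable {c : Matrix l l ℝ} (hc : cᵀ = -c)
include hc

omit [Fintype ν] [DecidableEq l] in
/-- [folklore] `(c·c)ᵀ = c·c` for an antisymmetric `c`. -/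
theorem sq_transpose : (c * c)ᵀ = c * c := by
  rw [Matrix.transpose_mul, hc, neg_mul_neg]

omit [Fintype ν] [DecidableEq l] in
/-- [folklore] `cᵀ·c = −(c·c)`. -/
theorem transpose_mul_self : cᵀ * c = -(c * c) := by
  rw [hc, neg_mul]

/-- [folklore] FIRST ORDER, TRANSPOSED SIDE, from the one-sided letter and the PARITY TYPES (`K₀` symmetric, `k₁` antisymmetric):
`k₁W₀ + K₀w₁ = 0 ⟹ (c⊗k₁)ᵀ(1⊗W₀) + (1⊗K₀)ᵀ(c⊗w₁) = 0`. -/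
theorem lift_rel₁_transpose {K₀ k₁ : Matrix ν ν ℝ} {W₀ w₁ : Matrix ν ρ ℝ} (hK₀ : K₀ᵀ = K₀) (hk₁ : k₁ᵀ = -k₁)
    (h : k₁ * W₀ + K₀ * w₁ = 0) :
    (c ⊗ₖ k₁)ᵀ * ((1 : Matrix l l ℝ) ⊗ₖ W₀) + ((1 : Matrix l l ℝ) ⊗ₖ K₀)ᵀ * (c ⊗ₖ w₁) = 0 := by
  rw [kronecker_transpose', kronecker_transpose', hc, hk₁, neg_kronecker_neg, Matrix.transpose_one, hK₀]
  exact lift_rel₁ c h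

/-- [folklore] SECOND ORDER (pure), TRANSPOSED SIDE (`K₀`, `k₂` symmetric, `k₁` antisymmetric). -/
theorem lift_rel₂_transpose {K₀ k₁ k₂ : Matrix ν ν ℝ} {W₀ w₁ w₂ : Matrix ν ρ ℝ} (hK₀ : K₀ᵀ = K₀) (hk₁ : k₁ᵀ = -k₁) (hk₂ : k₂ᵀ = k₂)
    (h : k₂ * W₀ + (2 : ℝ) • (k₁ * w₁) + K₀ * w₂ = 0) :
    ((c * c) ⊗ₖ k₂)ᵀ * ((1 : Matrix l l ℝ) ⊗ₖ W₀) + (2 : ℝ) • ((c ⊗ₖ k₁)ᵀ * (c ⊗ₖ w₁))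
      + ((1 : Matrix l l ℝ) ⊗ₖ K₀)ᵀ * ((c * c) ⊗ₖ w₂) = 0 := by
  rw [kronecker_transpose', kronecker_transpose', kronecker_transpose', sq_transpose hc, hk₂, hc, hk₁, neg_kronecker_neg,
    Matrix.transpose_one, hK₀]
  exact lift_rel₂ c h

/-- [folklore] SECOND ORDER (mixed), TRANSPOSED SIDE (`K₀`, `kₛₜ` symmetric, `kₛ`, `kₜ` antisymmetric). -/
theorem lift_rel_mix_transpose {K₀ kₛ kₜ kₛₜ : Matrix ν ν ℝ} {W₀ wₛ wₜ wₛₜ : Matrix ν ρ ℝ} (hK₀ : K₀ᵀ = K₀) (hkₛ : kₛᵀ = -kₛ)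
    (hkₜ : kₜᵀ = -kₜ) (hkₛₜ : kₛₜᵀ = kₛₜ) (h : kₛₜ * W₀ + kₛ * wₜ + kₜ * wₛ + K₀ * wₛₜ = 0) :
    ((c * c) ⊗ₖ kₛₜ)ᵀ * ((1 : Matrix l l ℝ) ⊗ₖ W₀) + (c ⊗ₖ kₛ)ᵀ * (c ⊗ₖ wₜ) + (c ⊗ₖ kₜ)ᵀ * (c ⊗ₖ wₛ)
      + ((1 : Matrix l l ℝ) ⊗ₖ K₀)ᵀ * ((c * c) ⊗ₖ wₛₜ) = 0 := by
  rw [kronecker_transpose', kronecker_transpose', kronecker_transpose', kronecker_transpose', sq_transpose hc, hkₛₜ, hc, hkₛ, hkₜ,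
    neg_kronecker_neg, neg_kronecker_neg, Matrix.transpose_one, hK₀]
  exact lift_rel_mix c h

end Ward

/-! ## §5 Lifted nondegeneracy -/

section Det

variable {l ν μ ρ : Type*} [Fintype l] [Fintype ν] [Fintype μ] [Fintype ρ] [DecidableEq l] [DecidableEq ν] [DecidableEq μ]
  [DecidableEq ρ]

omit [Fintype μ] [DecidableEq ν] [DecidableEq μ] in
/-- [folklore] `det ((1⊗X)·(1⊗Y)) ≠ 0` from `det (X·Y) ≠ 0`. -/
theorem det_lift_mul_ne_zero {X : Matrix ρ ν ℝ} {Y : Matrix ν ρ ℝ} (h : (X * Y).det ≠ 0) :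
    (((1 : Matrix l l ℝ) ⊗ₖ X) * ((1 : Matrix l l ℝ) ⊗ₖ Y)).det ≠ 0 := by
  rw [← Matrix.mul_kronecker_mul, Matrix.one_mul]
  exact det_one_kronecker_ne_zero h

/-- [folklore] The lifted comb-gauged bordered matrix is nondegenerate: `det kkt (1⊗K₀) [1⊗Q₀; 1⊗τ] ≠ 0` from `det kkt K₀ [Q₀; τ] ≠ 0`. -/
theorem det_kkt_lift_ne_zero {K₀ : Matrix ν ν ℝ} {Q₀ : Matrix μ ν ℝ} {τ : Matrix ρ ν ℝ} (hM : (kkt K₀ (fromRows Q₀ τ)).det ≠ 0) :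
    (kkt ((1 : Matrix l l ℝ) ⊗ₖ K₀) (fromRows ((1 : Matrix l l ℝ) ⊗ₖ Q₀) ((1 : Matrix l l ℝ) ⊗ₖ τ))).det ≠ 0 := by
  rw [kkt_kronecker_symm Matrix.transpose_one, Matrix.det_reindex_self]
  exact det_one_kronecker_ne_zero hM

end Det

end Summit.QuantumFields.BalabanUV.Beta.D1BFx.ColourLift
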